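import Summits.BirchSwinnertonDyer.BirchSwinnertonDyer.Theorems.KimAtThreeDeepLowerOffStratumLevelLoweringVatsalStabRows
import HarnessLib

/-!
# Route `KimAtThreeKolyvagin` (rung W2), crux `DeepLowerAtThreeOffKatoStratum` (item 19679), registered
# stub `stub_nonAdditive`, ROAD (b²): the `q`-STABILISATION of an ARBITRARY normalised Hecke eigenform (not only a
# newform) — THEOREM B of gen 4 with `IsNewform0 g` weakened to «eigenform + normalised (+ integral, number field)»

Cell `bsd-addord`, seat `bsd-addord-w2-acc2` (PROGRAMME PART 1b, ACCEL-LIST row (2)), gen 5; item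
`stmt-BirchSwinnertonDyer-19679` (OWNER w2-c2 assembles; `--supports`, closes nothing). Planner ROW CENSUS
(STATUS ROUTING 2026-08-27T03:35:16Z): 8 978 of the 29 656 semistable depth-`1` rows fail the (R1) fact's clauses
(F1)/(F2) because `ρ̄_{E,3}` is unramified (or finite) at ONE MORE bad prime `ℓ′ ≠ q` (non-split multiplicative with
`3 ∣ ord_{ℓ′} Δ`, or `ℓ′ = 3`); 8 107 of them have EXACTLY one such `ℓ′`. There Ribet/Diamond lower the level to
the optimal `M₀ = N/(qℓ′)` and the comparison form for Vatsal's congruence is the DOUBLE stabilisation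
`h = (ι₁ − β ι_q)(ι₁ − β′ ι_{ℓ′}) g` of the level-`M₀` newform `g` — the second stabilisation is applied to the
`ℓ′`-stabilised form `g′ = ι₁ g − β′ ι_{ℓ′} g`, which is a normalised eigenform but NOT a newform. Gen 4's
`…LevelLoweringVatsalStab` §2 / `…VatsalStabRows` §2 assume `IsNewform0`; THIS FILE re-proves them for an arbitrary
normalised Hecke eigenform `φ ∈ S₂(Γ₀(M))` (with `3`-integral coefficients in a number field where needed) —
theorems only, no definition, no fact, no `sorry`:

* §1 `cuspCoeff_mul_cuspCoeff` (Hecke recursion of a normalised eigenform), `heckeT_stab_of_ne` (`T_ℓ φ' = a_ℓ(φ) φ'`,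
  `ℓ ≠ q`, INCLUDING `ℓ ∣ M`), `heckeT_stab_self` (`U_q φ' = (a_q(φ) − β) φ'`), `isHeckeEigenform_stab`,
  `cuspCoeff_stab_prime`, `heckeEigenvalue_stab` — for `φ' = ι₁ φ − β ι_q φ`, `q ∤ M`, `β² − a_q(φ)β + q = 0`.
* §2 `valuation_cuspCoeff_stab_le_one` (integrality), `finiteDimensional_coeffField_stab` (number field).
* §3 `cuspCoeff_mul_plusSymbol_of_heckeT` — the Hecke relation `a·plusSymbol φ (x) = Σ_j plusSymbol φ ((x+j)/p) +
  plusSymbol φ (px)` at a prime `p ∤ M` for ANY `φ` with `T_p φ = a φ` (from `modularSymbol_heckeT`).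

## References

* F. Diamond, J. Shurman, *A First Course in Modular Forms* (2005), §5.7, Prop. 5.2.2, Prop. 5.8.5. [DiamondShurman2005]
* B. Mazur, J. Tate, J. Teitelbaum, Invent. Math. 84 (1986), §I.4 (4.2), §I.10. [MazurTateTeitelbaum1986Invent]
* G. Shimura (1971), Thm. 3.48. [Shimura1971]
-/

set_option autoImplicit false
-- the Theorems namespace of a single-conjunct summit repeats the summit name by design (D-0017)
set_option linter.dupNamespace false

noncomputable section

open scoped MatrixGroups ModularForm Classical NNReal IntermediateField

open CongruenceSubgroup WeierstrassCurve Literature.NumberTheory.EllipticCurves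
  Literature.NumberTheory.EllipticCurves.ModularForms Polynomial
open UpperHalfPlane hiding I

namespace Summit.BirchSwinnertonDyer.BirchSwinnertonDyer.Theorems.KimAtThreeDeepLowerOffStratumLevelLoweringStabEigenform

open Summit.BirchSwinnertonDyer.BirchSwinnertonDyer.Theorems.KimAtThreeDeepLowerOffStratumLevelLoweringVatsal
open Summit.BirchSwinnertonDyer.BirchSwinnertonDyer.Theorems.KimAtThreeDeepLowerOffStratumLevelLoweringVatsalStab
open Summit.BirchSwinnertonDyer.BirchSwinnertonDyer.Theorems.KimAtThreeDeepLowerOffStratumLevelLoweringVatsalStabRows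

/-! ### §1 The stabilised form of a normalised eigenform is an eigenform at level `Mq` -/

section Hecke

variable {M q : ℕ} [NeZero M] [NeZero q] [NeZero (M * q)] {φ : CuspForm (Gamma0 M) 2}
  (heig : IsHeckeEigenform φ) (hnorm : IsNormalized φ) (β : ℂ) (h1 : M * 1 ∣ M * q) (hMq : M * q ∣ M * q)
include heig hnorm

/-- `a_ℓ(φ)·aₘ(φ) = a_{ℓm}(φ) + 𝟙_{ℓ ∤ M} ℓ 𝟙_{ℓ ∣ m} a_{m/ℓ}(φ)` for a NORMALISED EIGENFORM `φ ∈ S₂(Γ₀(M))` and a prime `ℓ`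
(Hecke recursion, Diamond–Shurman Prop. 5.8.5 — no newform hypothesis). [cite: DiamondShurman2005, Prop. 5.2.2(a) and Prop. 5.8.5] -/
theorem cuspCoeff_mul_cuspCoeff {ℓ : ℕ} (hℓ : ℓ.Prime) (m : ℕ) :
    cuspCoeff φ ℓ * cuspCoeff φ m =
      cuspCoeff φ (ℓ * m) + (if ℓ ∣ M then 0 else (ℓ : ℂ) * (if ℓ ∣ m then cuspCoeff φ (m / ℓ) else 0)) := by
  have h := heckeEigenvalue_mul_coeff heig hℓ m
  rw [heckeEigenvalue_eq_coeff_of_isNormalized hnorm hℓ (heig ℓ hℓ)] at h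
  simpa [cuspCoeff] using h

/-- **`T_ℓ φ' = a_ℓ(φ)·φ'` for every prime `ℓ ≠ q`** (including `ℓ ∣ M`, where `T_ℓ = U_ℓ`), `φ' = ι₁ φ − β ι_q φ`: compare
`q`-expansions through `qExpansion_coeff_heckeT_holds` and the recursion. [cite: DiamondShurman2005, Prop. 5.2.2(a) and §5.7] -/
theorem heckeT_stab_of_ne (hq : q.Prime) {ℓ : ℕ} [NeZero ℓ] (hℓ : ℓ.Prime) (hℓq : ℓ ≠ q) :
    heckeT (Gamma0 (M * q)) 2 ℓ (iota M (M * q) 1 2 h1 φ - β • iota M (M * q) q 2 hMq φ) =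
      cuspCoeff φ ℓ • (iota M (M * q) 1 2 h1 φ - β • iota M (M * q) q 2 hMq φ) := by
  set g' := iota M (M * q) 1 2 h1 φ - β • iota M (M * q) q 2 hMq φ with hg'
  refine sub_eq_zero.mp (eq_zero_of_qExpansion_coeff_eq_zero_level0 _ fun n => ?_)
  rw [qExpansion_coeff_sub_smul, sub_eq_zero, qExpansion_coeff_heckeT_holds (M * q) 2 g' ℓ hℓ n]
  have hco : ∀ m : ℕ, (qExpansion 1 ⇑g').coeff m = cuspCoeff φ m - β * (if q ∣ m then cuspCoeff φ (m / q) else 0) :=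
    fun m => cuspCoeff_stab φ β h1 hMq m
  have hℓMq : (ℓ ∣ M * q) ↔ ℓ ∣ M := by
    refine ⟨fun h => ?_, fun h => h.mul_right q⟩
    rcases (Nat.Prime.dvd_mul hℓ).mp h with h' | h'
    · exact h'
    · exact absurd ((Nat.prime_dvd_prime_iff_eq hℓ hq).mp h') hℓq
  have hcop : Nat.Coprime ℓ q := (Nat.coprime_primes hℓ hq).mpr hℓq
  have h21 : ((2 : ℤ) - 1) = 1 := by norm_num
  simp only [hco, hℓMq, h21, zpow_one]
  by_cases hqn : q ∣ n
  · obtain ⟨m, rfl⟩ := hqn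
    have e1 : ℓ * (q * m) / q = ℓ * m := by
      rw [show ℓ * (q * m) = q * (ℓ * m) by ring, Nat.mul_div_cancel_left _ hq.pos]
    have e2 : q * m / q = m := Nat.mul_div_cancel_left _ hq.pos
    have hqlm : q ∣ ℓ * (q * m) := ⟨ℓ * m, by ring⟩
    have hℓqm : (ℓ ∣ q * m) ↔ ℓ ∣ m := ⟨fun h => hcop.dvd_of_dvd_mul_left h, fun h => h.mul_left q⟩
    rw [if_pos hqlm, e1, if_pos (dvd_mul_right q m), e2]
    have R1 := cuspCoeff_mul_cuspCoeff heig hnorm hℓ (q * m)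
    have R2 := cuspCoeff_mul_cuspCoeff heig hnorm hℓ m
    by_cases hℓm : ℓ ∣ m
    · obtain ⟨r, rfl⟩ := hℓm
      have e3 : q * (ℓ * r) / ℓ = q * r := by
        rw [show q * (ℓ * r) = ℓ * (q * r) by ring, Nat.mul_div_cancel_left _ hℓ.pos]
      have e4 : ℓ * r / ℓ = r := Nat.mul_div_cancel_left _ hℓ.pos
      have e5 : q * r / q = r := Nat.mul_div_cancel_left _ hq.pos
      have hℓn : ℓ ∣ q * (ℓ * r) := hℓqm.mpr (dvd_mul_right ℓ r)
      rw [if_pos hℓn, e3, if_pos (dvd_mul_right q r), e5]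
      rw [if_pos hℓn, e3] at R1
      rw [if_pos (dvd_mul_right ℓ r), e4] at R2
      split_ifs at R1 R2 ⊢ <;> linear_combination (-1 : ℂ) * R1 + β * R2
    · have hℓn : ¬ ℓ ∣ q * m := fun h => hℓm (hℓqm.mp h)
      rw [if_neg hℓn]
      rw [if_neg hℓn] at R1
      rw [if_neg hℓm] at R2
      split_ifs at R1 R2 ⊢ <;> linear_combination (-1 : ℂ) * R1 + β * R2
  · have hqln : ¬ q ∣ ℓ * n := fun h => hqn (hcop.symm.dvd_of_dvd_mul_left h)
    rw [if_neg hqln, if_neg hqn]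
    by_cases hℓn : ℓ ∣ n
    · obtain ⟨r, rfl⟩ := hℓn
      have e4 : ℓ * r / ℓ = r := Nat.mul_div_cancel_left _ hℓ.pos
      have hqr : ¬ q ∣ r := fun h => hqn (h.mul_left ℓ)
      have R1 := cuspCoeff_mul_cuspCoeff heig hnorm hℓ (ℓ * r)
      rw [if_pos (dvd_mul_right ℓ r), e4, if_neg hqr]
      rw [if_pos (dvd_mul_right ℓ r), e4] at R1
      split_ifs at R1 ⊢ <;> linear_combination (-1 : ℂ) * R1
    · have R1 := cuspCoeff_mul_cuspCoeff heig hnorm hℓ n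
      rw [if_neg hℓn]
      rw [if_neg hℓn] at R1
      split_ifs at R1 ⊢ <;> linear_combination (-1 : ℂ) * R1

/-- **`U_q φ' = α·φ'` with `α = a_q(φ) − β`** when `β² − a_q(φ)β + q = 0` and `q ∤ M`. [cite: DiamondShurman2005, Prop. 5.2.2(a) and §5.7] -/
theorem heckeT_stab_self (hq : q.Prime) (hqM : ¬ q ∣ M) (hβ : β ^ 2 - cuspCoeff φ q * β + q = 0) :
    heckeT (Gamma0 (M * q)) 2 q (iota M (M * q) 1 2 h1 φ - β • iota M (M * q) q 2 hMq φ) =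
      (cuspCoeff φ q - β) • (iota M (M * q) 1 2 h1 φ - β • iota M (M * q) q 2 hMq φ) := by
  set g' := iota M (M * q) 1 2 h1 φ - β • iota M (M * q) q 2 hMq φ with hg'
  refine sub_eq_zero.mp (eq_zero_of_qExpansion_coeff_eq_zero_level0 _ fun n => ?_)
  rw [qExpansion_coeff_sub_smul, sub_eq_zero, qExpansion_coeff_heckeT_holds (M * q) 2 g' q hq n,
    if_pos (dvd_mul_left q M), add_zero]
  have hco : ∀ m : ℕ, (qExpansion 1 ⇑g').coeff m = cuspCoeff φ m - β * (if q ∣ m then cuspCoeff φ (m / q) else 0) :=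
    fun m => cuspCoeff_stab φ β h1 hMq m
  rw [hco, hco, if_pos (dvd_mul_right q n), Nat.mul_div_cancel_left _ hq.pos]
  have R := cuspCoeff_mul_cuspCoeff heig hnorm hq n
  rw [if_neg hqM] at R
  by_cases hqn : q ∣ n
  · obtain ⟨m, rfl⟩ := hqn
    have e2 : q * m / q = m := Nat.mul_div_cancel_left _ hq.pos
    rw [if_pos (dvd_mul_right q m), e2]
    rw [if_pos (dvd_mul_right q m), e2] at R
    linear_combination (-1 : ℂ) * R - cuspCoeff φ m * hβ
  · rw [if_neg hqn]
    rw [if_neg hqn] at R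
    linear_combination (-1 : ℂ) * R

/-- The stabilised form of a normalised eigenform is a Hecke eigenform at level `Mq`. [cite: DiamondShurman2005, §5.7 and Prop. 5.8.5] -/
theorem isHeckeEigenform_stab (hq : q.Prime) (hqM : ¬ q ∣ M) (hβ : β ^ 2 - cuspCoeff φ q * β + q = 0) :
    IsHeckeEigenform (iota M (M * q) 1 2 h1 φ - β • iota M (M * q) q 2 hMq φ) := by
  intro ℓ hℓ
  haveI : NeZero ℓ := ⟨hℓ.ne_zero⟩
  by_cases hℓq : ℓ = q
  · subst hℓq
    exact ⟨_, heckeT_stab_self heig hnorm β h1 hMq hq hqM hβ⟩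
  · exact ⟨_, heckeT_stab_of_ne heig hnorm β h1 hMq hq hℓ hℓq⟩

omit [NeZero M] heig in
/-- Prime coefficients of the stabilised form: `a_ℓ(φ') = a_ℓ(φ)` (`ℓ ≠ q`), `a_q(φ') = a_q(φ) − β`.
[cite: DiamondShurman2005, §5.7 (ι_d on Fourier expansions)] -/
theorem cuspCoeff_stab_prime (hq : q.Prime) {ℓ : ℕ} (hℓ : ℓ.Prime) :
    cuspCoeff (iota M (M * q) 1 2 h1 φ - β • iota M (M * q) q 2 hMq φ) ℓ =
      if ℓ = q then cuspCoeff φ q - β else cuspCoeff φ ℓ := by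
  rw [cuspCoeff_stab]
  by_cases hℓq : ℓ = q
  · subst hℓq
    rw [if_pos dvd_rfl, Nat.div_self hq.pos, if_pos rfl, show cuspCoeff φ 1 = 1 from hnorm, mul_one]
  · have : ¬ q ∣ ℓ := fun h => hℓq ((Nat.prime_dvd_prime_iff_eq hq hℓ).mp h).symm
    rw [if_neg this, if_neg hℓq, mul_zero, sub_zero]

/-- The Hecke eigenvalues of the stabilised form: `a_ℓ(φ)` for `ℓ ≠ q`, `a_q(φ) − β` at `q`.
[cite: DiamondShurman2005, §5.7 (ι_d on Fourier expansions)] -/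
theorem heckeEigenvalue_stab (hq : q.Prime) (hqM : ¬ q ∣ M) (hβ : β ^ 2 - cuspCoeff φ q * β + q = 0) {ℓ : ℕ}
    (hℓ : ℓ.Prime) :
    heckeEigenvalue (iota M (M * q) 1 2 h1 φ - β • iota M (M * q) q 2 hMq φ) ℓ =
      if ℓ = q then cuspCoeff φ q - β else cuspCoeff φ ℓ := by
  rw [heckeEigenvalue_eq_coeff_of_isNormalized (isNormalized_stab φ β h1 hMq hnorm hq) hℓ
    (isHeckeEigenform_stab heig hnorm β h1 hMq hq hqM hβ ℓ hℓ)]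
  exact cuspCoeff_stab_prime hnorm β h1 hMq hq hℓ

end Hecke

/-! ### §2 Integrality and number field of the stabilised coefficients -/

section Data

variable {M q : ℕ} [NeZero M] [NeZero q] {φ : CuspForm (Gamma0 M) 2} (ι : PadicAlgCl 3 ≃+* ℂ) (β : ℂ)
  (h1 : M * 1 ∣ M * q) (hMq : M * q ∣ M * q)

omit [NeZero M] in
/-- The coefficients of the stabilised form are `3`-integral when those of `φ` are and `β` is a root of the Hecke
polynomial at `q`. [cite: Shimura1971, Thm. 3.48] -/
theorem valuation_cuspCoeff_stab_le_one (hint : ∀ n : ℕ, Valued.v (ι.symm (cuspCoeff φ n)) ≤ 1)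
    (hβ : β ^ 2 - cuspCoeff φ q * β + q = 0) (n : ℕ) :
    Valued.v (ι.symm (cuspCoeff (iota M (M * q) 1 2 h1 φ - β • iota M (M * q) q 2 hMq φ) n)) ≤ 1 := by
  have hβ' : ‖ι.symm β‖ ≤ 1 := by
    refine norm_root_le_one (a := ι.symm (cuspCoeff φ q)) (q := q) (valuation_le_one_iff.mp (hint q)) ?_
    have h := congrArg ι.symm hβ
    rwa [map_add, map_sub, map_pow, map_mul, map_natCast, map_zero] at h
  have hco := cuspCoeff_stab φ β h1 hMq n
  rw [hco, map_sub, map_mul, sub_eq_add_neg]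
  refine valuation_le_one_iff.mpr ((PadicAlgCl.isNonarchimedean 3 _ _).trans (max_le ?_ ?_))
  · exact valuation_le_one_iff.mp (hint n)
  · rw [norm_neg, norm_mul]
    refine mul_le_one₀ hβ' (norm_nonneg _) ?_
    by_cases hqn : q ∣ n
    · rw [if_pos hqn]
      exact valuation_le_one_iff.mp (hint _)
    · rw [if_neg hqn, map_zero, norm_zero]
      exact zero_le_one

omit [NeZero M] in
/-- The coefficient field of the stabilised form is a number field when that of `φ` is: it lies in `K_φ(β)`.
[cite: Shimura1971, Thm. 3.48] -/
theorem finiteDimensional_coeffField_stab (hfd : FiniteDimensional ℚ (coeffField φ))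
    (hβ : β ^ 2 - cuspCoeff φ q * β + q = 0) :
    FiniteDimensional ℚ (coeffField (iota M (M * q) 1 2 h1 φ - β • iota M (M * q) q 2 hMq φ)) := by
  set K : IntermediateField ℚ ℂ := coeffField φ with hK
  haveI : FiniteDimensional ℚ K := hfd
  set a : K := ⟨cuspCoeff φ q, coeff_mem_coeffField φ q⟩ with ha
  have hβint : IsIntegral K β := by
    refine ⟨X ^ 2 + (-(C a * X) + C (q : K)), ?_, ?_⟩
    · refine monic_X_pow_add ?_
      refine lt_of_le_of_lt (degree_add_le _ _) (max_lt ?_ ?_)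
      · rw [degree_neg]
        exact lt_of_le_of_lt (degree_C_mul_X_le a) (by decide)
      · exact lt_of_le_of_lt degree_C_le (by decide)
    · have : eval₂ (algebraMap K ℂ) β (X ^ 2 + (-(C a * X) + C (q : K))) = β ^ 2 - cuspCoeff φ q * β + q := by
        simp [ha]
        ring
      rw [this, hβ]
  haveI : FiniteDimensional K K⟮β⟯ := IntermediateField.adjoin.finiteDimensional hβint
  haveI hL : FiniteDimensional ℚ K⟮β⟯ := Module.Finite.trans K K⟮β⟯
  set L' : IntermediateField ℚ ℂ := IntermediateField.restrictScalars ℚ K⟮β⟯ with hL'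
  haveI : FiniteDimensional ℚ L' := hL
  have hle : coeffField (iota M (M * q) 1 2 h1 φ - β • iota M (M * q) q 2 hMq φ) ≤ L' := by
    rw [coeffField, IntermediateField.adjoin_le_iff]
    rintro _ ⟨n, rfl⟩
    show (qExpansion 1 ⇑(iota M (M * q) 1 2 h1 φ - β • iota M (M * q) q 2 hMq φ)).coeff n ∈ K⟮β⟯
    have hco := cuspCoeff_stab φ β h1 hMq n
    rw [cuspCoeff] at hco
    rw [hco]
    have hmemK : ∀ m : ℕ, cuspCoeff φ m ∈ K⟮β⟯ := fun m =>
      IntermediateField.algebraMap_mem K⟮β⟯ (⟨cuspCoeff φ m, coeff_mem_coeffField φ m⟩ : K)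
    refine sub_mem (hmemK n) (mul_mem (IntermediateField.mem_adjoin_simple_self K β) ?_)
    split_ifs
    · exact hmemK _
    · exact zero_mem _
  exact FiniteDimensional.of_injective (IntermediateField.inclusion hle).toLinearMap
    (IntermediateField.inclusion_injective hle)

end Data

/-! ### §3 The Hecke relation for the plus symbol of any `T_p`-eigenvector -/

section PlusHecke

variable {M : ℕ} [NeZero M] (p : ℕ) [NeZero p]

/-- **`a·plusSymbol φ (x) = Σ_{j mod p} plusSymbol φ ((x+j)/p) + plusSymbol φ (px)`** for `p ∤ M` prime and ANY
`φ ∈ S₂(Γ₀(M))` with `T_p φ = a φ` (`modularSymbol_heckeT` at `x` and `−x`, reflected with periodicity — the proof of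
the tree's `cuspCoeff_mul_plusSymbol` minus the newform hypothesis). [cite: MazurTateTeitelbaum1986Invent, §I.4 (4.2)] -/
theorem smul_plusSymbol_of_heckeT {φ : CuspForm (Gamma0 M) 2} {a : ℂ} (hp : p.Prime) (hpM : ¬ p ∣ M)
    (hT : heckeT (Gamma0 M) 2 p φ = a • φ) (r : ℚ) :
    a * plusSymbol φ r = ∑ j : Fin p, plusSymbol φ ((r + j) / p) + plusSymbol φ (p * r) := by
  have key : ∀ s : ℚ, a * modularSymbol φ s = ∑ j : Fin p, modularSymbol φ ((s + j) / p) + modularSymbol φ (p * s) := by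
    intro s
    rw [← modularSymbol_heckeT φ p hp hpM s, hT, modularSymbol_smul]
  have h1 := key r
  have h2 := key (-r)
  have hrefl : ∑ j : Fin p, modularSymbol φ ((-r + j) / p) = ∑ j : Fin p, modularSymbol φ (-((r + j) / p)) := by
    rw [← sum_fin_reflect_of_periodic p (modularSymbol φ) (fun x ↦ by
      exact_mod_cast modularSymbol_add_intCast_holds φ x 1) (-r)]
    refine Finset.sum_congr rfl fun j _ ↦ ?_
    congr 1
    ring
  rw [hrefl] at h2
  have hsum : ∑ j : Fin p, plusSymbol φ ((r + j) / p) =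
      (∑ j : Fin p, modularSymbol φ ((r + j) / p) + ∑ j : Fin p, modularSymbol φ (-((r + j) / p))) / 2 := by
    simp only [plusSymbol]
    rw [← Finset.sum_add_distrib, Finset.sum_div]
  have hneg : modularSymbol φ ((p : ℚ) * -r) = modularSymbol φ (-((p : ℚ) * r)) := by rw [mul_neg]
  rw [hsum, plusSymbol, plusSymbol, mul_div_assoc', mul_add, h1, h2, hneg]
  ring

end PlusHecke

end Summit.BirchSwinnertonDyer.BirchSwinnertonDyer.Theorems.KimAtThreeDeepLowerOffStratumLevelLoweringStabEigenform

end
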